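import Literature.Combinatorics.Kakeya.Tao2005UnitSphereCounts

/-!
# Tao's quadric example: sections of the unit sphere by affine `3`-spaces — at most `q² + q`
points and `2 (q + 1)` lines of `L`, for a general nondegenerate form (Tao 2005,
Proposition 1.3: the Wolff axiom with the sharp constant)

Topic `Literature/Combinatorics/Kakeya`.  Everything in this file is PROVED (no named fact, no
`sorry`).  Fourth companion of `Literature.Combinatorics.Kakeya.Tao2005Quadric` (split form
`det` on `M₂(K)`: exact counts, and the Wolff axiom with the sharp constants `2` and `2 (q + 1)`),
`Literature.Combinatorics.Kakeya.Tao2005UnitSphere` (arbitrary nondegenerate symmetric form on a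
`4`-space: the Wolff axiom with the constants `2` and `8q`) and
`Literature.Combinatorics.Kakeya.Tao2005UnitSphereCounts` (arbitrary form: exact cardinalities):
here the `3`-space clause of the Wolff axiom is proved with the SHARP constant `2 (q + 1)` for
every nondegenerate symmetric form, together with the sharp point bound `q² + q` for the
sections of `P` by affine `3`-spaces, and both bounds are shown to be attained (by the `3`-space
of a hyperbolic frame), in the vocabulary of `Tao2005UnitSphere` (`sphere`, `lineSet`,
`lineSetIn`, `linesThroughIn`, `translate`), which this file imports (through
`Tao2005UnitSphereCounts`) and extends (same namespace).

T. Tao, *A new bound for finite field Besicovitch sets in four dimensions*, Pacific J. Math.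
**222** (2005), no. 2, 337–363 (doi:10.2140/pjm.2005.222.337), §1, p. 338, verbatim from the printed
journal text (arXiv:math/0204251 numbers the items Definition 1 and Proposition 3):

> **Definition 1.1.** A family `L` of lines in `Fⁿ` is said to obey the *Wolff axiom* if for
> every `2 ≤ k ≤ n − 1`, every `k`-dimensional affine subspace `V ⊂ Fⁿ` contains at most
> `O(|F|^{k−1})` lines in `L`. (Here we view the field `F` as being quite large, and the family `L`
> as depending on `F`. The implied constant in the `O( )` notation may depend on `n` and `k` but
> is uniform in `F`. Also Recall that an affine subspace is a translate of a vector subspace of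
> `Fⁿ`.)
>
> **Proposition 1.3.** Let `⟨ , ⟩ : F⁴ × F⁴ → F` be a nondegenerate symmetric quadratic form on
> `F⁴`. Let `P` be the "unit sphere" (1–1) `P := {x ∈ F⁴ : ⟨x, x⟩ = 1}` and let `L` be the set
> of all lines of the form `{x + tv : t ∈ F}`, where `x ∈ F⁴`, `v ∈ F⁴ ∖ {0}` are such that
> `⟨x, x⟩ = 1`, `⟨v, x⟩ = 0`, and `⟨v, v⟩ = 0`. Then `L` has cardinality `|L| ∼ |F|³` and obeys
> the Wolff axiom, while `P` has cardinality `|P| ∼ |F|³` and contains all the lines in `L`.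

The Wolff axiom is verified at the end of the proof, §3, p. 342, verbatim:

> It remains to verify the Wolff axiom. First pick a 3-space `λ` and consider the lines in `L`
> which go through `λ`. Pick an arbitrary point `x₀` in `λ`, so that `λ − x₀` is a
> three-dimensional subspace of `F⁴`. By Lemma 3.1, the number of null vectors
> `{v ∈ λ − x₀ : ⟨v, v⟩ = 0}` is `O(|F|²)`. Fix `v` as above. There are two cases. If
> `v^⊥ ≢ (λ − x₀)`, then there are `O(|F|)` choices of `x ∈ λ` such that `⟨x, v⟩ = 0` and
> `⟨x, x⟩ = 1`. But if `v^⊥ ≡ (λ − x₀)`, then the number of choices for `x` could be as large as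
> `O(|F|²)`. But `(λ − x₀)^⊥` only has cardinality `O(|F|)`, hence the number of `v` in the second
> category is at most `O(|F|)`. Thus the number of pairs `(x, v)` which can generate a line in `λ`
> is at most `O(|F|³)`. But each line is generated by `∼ |F|²` pairs `(x, v)`. Thus the number of
> lines in `λ` is at most `O(|F|)`, which clearly implies the Wolff axiom for both `k = 2` and
> `k = 3`. This completes the proof of Proposition 1.3.

and §3 opens (p. 340): "It is likely that Proposition 1.3 follows from the standard theory of
Fano varieties of quadric surfaces, but we will just give an elementary argument."  The sharp
value of this `O(|F|)` is `2 (q + 1)`, the number of lines on a hyperbolic quadric surface of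
`PG(3, q)` (a regulus and its opposite regulus; the surface has `(q + 1)²` points —
J. W. P. Hirschfeld, *Projective Geometries over Finite Fields*, 2nd ed., OUP 1998, Thm 5.2.6 (ii)
with `s = 2` — so that `q² + q = (q + 1)² − (q + 1)` is the number of its points off a conic plane
section); for the split form it is `Tao2005Quadric.ncard_linesInZIn_space_le_sharp`.

## Setting

As in `Tao2005UnitSphere`: `K` a field with `(2 : K) ≠ 0` (Tao's `char F ≠ 2`), finite where
counts occur, `q = Nat.card K` (odd, `≥ 3`: `two_lt_card`); `V` a `K`-space with
`finrank K V = 4` (`2`, `3` in the level-set lemmas); `B : LinearMap.BilinForm K V` nondegenerate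
and symmetric; `P = sphere B = {⟨y, y⟩ = 1}`, `L = lineSet B`.  An affine `3`-space is
`translate x₀ U = x₀ + U` with `finrank K U = 3` (Tao's `λ`, with `λ − x₀ = U`); it lies in the
hyperplane `{y : ⟨w, y⟩ = ⟨w, x₀⟩}` for a vector `w ≠ 0` spanning the line `U^⊥`.

## What is proved

* `ncard_lineSetIn_le_sharp` — **every affine `3`-space `x₀ + U` contains at most `2 (q + 1)`
  lines of `L`**, for every nondegenerate symmetric `B` on a `4`-space over `𝔽_q`, `q` odd;
  `wolffAxiom_sharp` (`wolffAxiom_sharp_fin` on `Fin 4 → K`) — Definition 1.1 for `n = 4` with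
  the constants `2` (`k = 2`, `Tao2005UnitSphere.ncard_lineSetIn_plane_le_two`) and `2 (q + 1)`
  (`k = 3`); `prop13_sharp` (`prop13_sharp_fin`) — Proposition 1.3 with every constant sharp or
  exact: `P` contains the lines of `L`, `|P| ∈ {q³ − q, q³ + q}` and `|L| · q = |P| · (q + 1)`
  (from `Tao2005UnitSphereCounts`), at most `2` lines of `L` in an affine `2`-plane, at most
  `q² + q` points of `P` and at most `2 (q + 1)` lines of `L` in an affine `3`-space.
* `ncard_translate_inter_sphere_le_sharp` — **`|P ∩ (x₀ + U)| ≤ q² + q`** for every affine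
  `3`-space (`Tao2005UnitSphere.ncard_translate_inter_sphere_le` has `2q²`), through
  `natCard_section_le` — `|{y : ⟨w, y⟩ = κ, ⟨y, y⟩ = 1}| ≤ q² + q` for every `w ≠ 0` and every
  `κ` — by cases: `natCard_section_le_of_apply_self_ne_zero` (`⟨w, w⟩ ≠ 0`: a translate of a
  level set of the nondegenerate `3`-space `w^⊥`), `natCard_section_le_of_null` (`⟨w, w⟩ = 0`,
  `κ ≠ 0`: at most `q²`, one point on each line `y + K w` of the hyperplane),
  `natCard_section_le_of_null_zero` (`⟨w, w⟩ = 0`, `κ = 0`: `q` times a nonzero level set of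
  the nondegenerate plane `{w, f}^⊥`, `f` a hyperbolic partner of `w`).
* The level-set bounds used: `natCard_level_three_le` — **a nondegenerate ternary form takes
  every value at most `q² + q` times**; `natCard_level_two_le` — **a nondegenerate binary form
  takes every nonzero value at most `q + 1` times** (both read off the exact counts of
  `Tao2005UnitSphereCounts`); `natCard_sq_eq_le_two`; `apply_sub_smul_self`.
* `exceptional_point_unique` — at most ONE point `p ∈ P ∩ (x₀ + U)` has `U ⊆ p^⊥`
  (`Tao2005UnitSphere.no_three_bad` allowed two); `ncard_linesThroughIn_le_card_add_one` —
  through a point of `P` pass at most `q + 1` lines of `L` inside any set (exactly `q + 1` in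
  all, `Tao2005UnitSphereCounts.ncard_linesThrough`).

## Proof architecture (and where it departs from the paper)

Tao bounds the pairs `(x, v)` generating a line inside `λ` (quoted above) and gets `O(|F|)`
lines.  Here, as in `Tao2005UnitSphere.ncard_lineSetIn_le`, the incidences `(p, ℓ)` with
`p ∈ ℓ ⊆ λ = x₀ + U`, `ℓ ∈ L`, are double counted: `q · #lines = Σ_p #(lines of L through p
inside λ)` (`Tao2005UnitSphere.incidenceEquivIn`, `natCard_incidence`).  Through a point
`p ∈ P ∩ λ` with `U ⊄ p^⊥` pass at most two such lines
(`Tao2005UnitSphere.ncard_linesThroughIn_le_two`); a point with `U ⊆ p^⊥` lies on the line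
`U^⊥`, and two such points `p`, `c p` of `λ` would have `c p − p ∈ U ⊆ p^⊥`, forcing `c = 1` — so
there is at most one (it exists iff `λ` is the tangent hyperplane `p + p^⊥`, whose section is
the cone of the `q + 1` lines of `L` through `p`), and through it pass at most `q + 1` lines.
Hence `q · #lines ≤ 2 |P ∩ λ| + (q − 1)`, and the point bound
`|P ∩ λ| ≤ q² + q` (in place of Lemma 3.1's `O(|F|²)`) gives `q · #lines ≤ 2q² + 3q − 1 <
q (2q + 3)`.  For the point bound, `λ` is placed in a hyperplane `{⟨w, y⟩ = κ}` and three cases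
are distinguished: `w` non-null — translating by `(κ / ⟨w, w⟩) w` lands in a level set of the
nondegenerate ternary space `w^⊥`, whose level sets `Tao2005UnitSphereCounts` counts exactly
(`q² − q`, `q²` or `q² + q`); `w` null and `κ ≠ 0` — along a line `y + K w` of the hyperplane the
form is the non-constant affine function `1 + 2 t κ` of `t`, so each of the `q²` such lines
carries at most one point (an injection of (section) `× K` into the hyperplane, which has `q³`
points); `w` null and `κ = 0` — with a hyperbolic partner `f`
(`Tao2005UnitSphereCounts.exists_hyperbolic_partner`) the map `y ↦ (⟨f, y⟩, y − ⟨f, y⟩ w)`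
embeds the section into `K × {h ∈ {w, f}^⊥ : ⟨h, h⟩ = 1}`, and the nondegenerate plane
`{w, f}^⊥` takes the value `1` exactly `q ∓ 1` times.  No projective geometry is used, and the
classification of the sections (hyperbolic, elliptic, conic) is neither needed nor formalized.

* `exists_translate_ncard_eq` — **both bounds are attained, for every nondegenerate form:**
  some affine `3`-space contains exactly `2 (q + 1)` lines of `L` and exactly `q² + q` points of
  `P`.  It is the `3`-space `span {e, f} + K g` of a hyperbolic frame (`exists_frame`: a
  hyperbolic pair `e, f` and a unit vector `g ⊥ e, f`; `orthogonal_hyperbolic_pair`: `{e, f}^⊥`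
  is a nondegenerate plane), on which the form is `2ab + c²` (`apply_frame`):
  `ncard_lineSetIn_frame` exhibits the `2 (q + 1)` distinct lines
  `{λ e + σ g + t (−λ² e + 2 f − 2 σ λ g)}`, `{σ g + t e}` (`σ = ±1`, `λ ∈ K`; told apart by the
  coordinates `frame_coords_of_eq_add_smul`, `frame_coords_of_eq_smul`, `exists_of_line_eq`),
  and `ncard_translate_inter_sphere_frame` counts `#{2ab + c² = 1} = q² + q`
  (`Tao2005UnitSphereCounts.natCard_level_three_of_isotropic`); `mem_frame_iff`,
  `finrank_frame`.

## Not in this file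

* The classification of the sections: which affine `3`-spaces contain exactly `2 (q + 1)` lines
  of `L` (all hyperbolic sections), which fewer.
* The real version ("a similar counterexample can be created in `ℝ⁴` as long as one chooses the
  form `⟨ , ⟩` to be indefinite", p. 338).

## References
* [Tao2005FiniteFieldBesicovitch4D] T. Tao, Pacific J. Math. 222 (2005), no. 2, 337–363 —
  Def. 1.1 and Prop. 1.3 (§1, p. 338); §3, p. 340 (Fano varieties remark) and p. 342 (proof of
  the Wolff axiom).
* [Hirschfeld1998] J. W. P. Hirschfeld, Projective Geometries over Finite Fields, 2nd ed. (1998) —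
  §5.2, Theorem 5.2.4, Corollary 1 (projective index) and Theorem 5.2.6 (ii)
  (`ψ₊(2s − 1, q) = (q^{s−1} + 1)(q^s − 1)/(q − 1)`, so `|ℋ₃| = (q + 1)²`).
-/

namespace Literature.Combinatorics.Kakeya

namespace Tao2005UnitSphere

open Module

variable {K : Type*} [Field K] {V : Type*} [AddCommGroup V] [Module K V]
  {B : LinearMap.BilinForm K V}

section LevelBounds

/-- The equation `a s² = m` with `a ≠ 0` has at most two solutions `s`. [folklore] -/
theorem natCard_sq_eq_le_two {a : K} (ha : a ≠ 0) (m : K) :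
    Nat.card {s : K // a * s ^ 2 = m} ≤ 2 := by
  have h := ncard_quadratic_le_two (β := 0) (γ := -m) ha
  have hset : {t : K | a * t ^ 2 + 0 * t + -m = 0} = {s : K | a * s ^ 2 = m} := by
    ext s
    simp only [Set.mem_setOf_eq]
    constructor <;> intro h <;> linear_combination h
  rw [hset, ← Nat.card_coe_set_eq] at h
  exact h

/-- **Ternary forms: every level set has at most `q² + q` elements** (nondegenerate symmetric
form on a `3`-space over `𝔽_q`, `q` odd; the exact values are `q² − q`, `q²`, `q² + q`).
[folklore] -/
theorem natCard_level_three_le [Finite K] [FiniteDimensional K V] (hB : B.Nondegenerate)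
    (hBs : B.IsSymm) (h2 : (2 : K) ≠ 0) (hV : finrank K V = 3) (m : K) :
    Nat.card {v : V // B v v = m} ≤ Nat.card K ^ 2 + Nat.card K := by
  obtain ⟨u, -, hu⟩ := exists_apply_self_ne_zero hB hBs h2 (U := ⊤)
    (by rw [finrank_top, hV]; norm_num)
  have hr := natCard_sq_eq_le_two hu m
  by_cases hiso : ∃ w ∈ B.orthogonal (K ∙ u), w ≠ 0 ∧ B w w = 0
  · have h := natCard_level_three_of_isotropic hB hBs h2 hV hu hiso m
    have h' := Nat.mul_le_mul_left (Nat.card K) hr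
    linarith
  · push Not at hiso
    have han : ∀ w ∈ B.orthogonal (K ∙ u), B w w = 0 → w = 0 := fun w hw hww => by
      by_contra h0
      exact hiso w hw h0 hww
    have h := natCard_level_three_of_anisotropic hB hBs h2 hV hu han m
    exact le_of_le_of_eq (Nat.le_add_right _ _) h

/-- **Binary forms: every nonzero level set has at most `q + 1` elements** (nondegenerate
symmetric form on a plane over `𝔽_q`, `q` odd; the exact values are `q ∓ 1`). [folklore] -/
theorem natCard_level_two_le [Finite K] [FiniteDimensional K V] (hB : B.Nondegenerate)
    (hBs : B.IsSymm) (h2 : (2 : K) ≠ 0) (hV : finrank K V = 2) {e : K} (he : e ≠ 0) :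
    Nat.card {v : V // B v v = e} ≤ Nat.card K + 1 := by
  by_cases hiso : ∃ w : V, w ≠ 0 ∧ B w w = 0
  · rw [natCard_level_two_of_isotropic hB hBs h2 hV hiso he]
    omega
  · push Not at hiso
    have han : ∀ w : V, B w w = 0 → w = 0 := fun w hw => by
      by_contra h0
      exact hiso w h0 hw
    rw [natCard_level_two_of_anisotropic hB hBs h2 hV han he]

end LevelBounds

section Section

/-- Expansion of `⟨y − c w, y − c w⟩` (symmetric `B`). [folklore] -/
theorem apply_sub_smul_self (hBs : B.IsSymm) (y w : V) (c : K) :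
    B (y - c • w) (y - c • w) = B y y - 2 * c * B w y + c ^ 2 * B w w := by
  simp only [map_sub, map_smul, LinearMap.sub_apply, LinearMap.smul_apply, smul_eq_mul]
  rw [hBs.eq y w]
  ring

/-- **Hyperplane sections with non-null normal.** If `⟨w, w⟩ ≠ 0` then the section
`{y : ⟨w, y⟩ = κ, ⟨y, y⟩ = 1}` of the unit sphere is a translate (by `(κ/⟨w, w⟩) w`) of a
level set of the nondegenerate `3`-space `w^⊥`, so it has at most `q² + q` points. [folklore] -/
theorem natCard_section_le_of_apply_self_ne_zero [Finite K] [FiniteDimensional K V]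
    (hB : B.Nondegenerate) (hBs : B.IsSymm) (h2 : (2 : K) ≠ 0) (h4 : finrank K V = 4) {w : V}
    (hw : B w w ≠ 0) (κ : K) :
    Nat.card {y : V // B w y = κ ∧ B y y = 1} ≤ Nat.card K ^ 2 + Nat.card K := by
  have : Finite V := Module.finite_of_finite K
  have hw0 : w ≠ 0 := ne_zero_of_apply_self_ne_zero hw
  have hW3 : finrank K (B.orthogonal (K ∙ w)) = 3 := by
    rw [LinearMap.BilinForm.finrank_orthogonal hB, h4, finrank_span_singleton hw0]
  have hB' :=
    LinearMap.BilinForm.restrict_nondegenerate_orthogonal_spanSingleton B hB hBs.isRefl hw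
  have hBs' := isSymm_restrict hBs (B.orthogonal (K ∙ w))
  set c : K := κ / B w w with hc
  have hcw : c * B w w = κ := div_mul_cancel₀ κ hw
  have hmem : ∀ y : {y : V // B w y = κ ∧ B y y = 1},
      (y : V) - c • w ∈ B.orthogonal (K ∙ w) := by
    intro y
    rw [mem_orthogonal_span_singleton_iff hBs, map_sub, map_smul, LinearMap.sub_apply,
      LinearMap.smul_apply, smul_eq_mul, hBs.eq _ w, y.2.1, hcw, sub_self]
  let φ : {y : V // B w y = κ ∧ B y y = 1} →
      {y' : B.orthogonal (K ∙ w) //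
        (B.restrict (B.orthogonal (K ∙ w))) y' y' = 1 - c * κ} :=
    fun y => ⟨⟨(y : V) - c • w, hmem y⟩, by
      simp only [LinearMap.BilinForm.restrict_apply, LinearMap.domRestrict_apply]
      rw [apply_sub_smul_self hBs, y.2.2, y.2.1]
      linear_combination c * hcw⟩
  have hφ : Function.Injective φ := by
    intro y₁ y₂ h
    have h' := congrArg (fun z => ((z.1 : B.orthogonal (K ∙ w)) : V)) h
    exact Subtype.ext (sub_left_injective h')
  exact (Nat.card_le_card_of_injective φ hφ).trans (natCard_level_three_le hB' hBs' h2 hW3 _)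

/-- **Hyperplane sections with null normal, not through the pole.** If `⟨w, w⟩ = 0`, `w ≠ 0`
and `κ ≠ 0` then `{y : ⟨w, y⟩ = κ, ⟨y, y⟩ = 1}` has at most `q²` points: along each line
`y + K w` of the hyperplane `{⟨w, y⟩ = κ}` (which has `q³` points) the form changes by
`2 t κ`, so it takes the value `1` at most once. [folklore] -/
theorem natCard_section_le_of_null [Finite K] [FiniteDimensional K V]
    (hB : B.Nondegenerate) (hBs : B.IsSymm) (h2 : (2 : K) ≠ 0) (h4 : finrank K V = 4) {w : V}
    (hw0 : w ≠ 0) (hw : B w w = 0) {κ : K} (hκ : κ ≠ 0) :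
    Nat.card {y : V // B w y = κ ∧ B y y = 1} ≤ Nat.card K ^ 2 := by
  have : Finite V := Module.finite_of_finite K
  -- a point `y₀` of the hyperplane `{⟨w, y⟩ = κ}`
  obtain ⟨z, hz⟩ : ∃ z : V, B w z ≠ 0 := by
    by_contra h
    push Not at h
    exact hw0 (hB.1 w h)
  set y₀ : V := (κ / B w z) • z with hy₀
  have hy₀κ : B w y₀ = κ := by rw [hy₀, map_smul, smul_eq_mul, div_mul_cancel₀ κ hz]
  -- the hyperplane is the translate `y₀ + w^⊥`, of cardinality `q³`
  have hW3 : finrank K (B.orthogonal (K ∙ w)) = 3 := by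
    rw [LinearMap.BilinForm.finrank_orthogonal hB, h4, finrank_span_singleton hw0]
  have hA : Nat.card (translate y₀ (B.orthogonal (K ∙ w))) = Nat.card K ^ 3 := by
    rw [natCard_translate, Module.natCard_eq_pow_finrank (K := K) (V := B.orthogonal (K ∙ w)),
      hW3]
  -- the injection `(y, t) ↦ y + t w`
  let ψ : {y : V // B w y = κ ∧ B y y = 1} × K → translate y₀ (B.orthogonal (K ∙ w)) :=
    fun p => ⟨(p.1 : V) + p.2 • w, by
      rw [mem_translate_iff, mem_orthogonal_span_singleton_iff hBs, map_sub, map_add, map_smul,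
        LinearMap.sub_apply, LinearMap.add_apply, LinearMap.smul_apply, smul_eq_mul, hw,
        mul_zero, add_zero, hBs.eq _ w, hBs.eq _ w, p.1.2.1, hy₀κ, sub_self]⟩
  have hψ : Function.Injective ψ := by
    rintro ⟨y₁, t₁⟩ ⟨y₂, t₂⟩ h
    have h' : (y₁ : V) + t₁ • w = y₂ + t₂ • w :=
      congrArg (fun z : translate y₀ (B.orthogonal (K ∙ w)) => (z : V)) h
    have hy₂ : (y₂ : V) = y₁ + (t₁ - t₂) • w := by
      rw [sub_smul, ← add_sub_assoc, h', add_sub_cancel_right]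
    have hQ := y₂.2.2
    rw [hy₂, apply_add_smul_self, hBs.eq _ w, y₁.2.1, y₁.2.2, hw, mul_zero, add_zero] at hQ
    have ht : (t₁ - t₂) * (2 * κ) = 0 := by linear_combination hQ
    have ht' : t₁ = t₂ := by
      rcases mul_eq_zero.1 ht with h0 | h0
      · exact sub_eq_zero.1 h0
      · exact absurd h0 (mul_ne_zero h2 hκ)
    subst ht'
    have hy : (y₁ : V) = y₂ := add_right_cancel h'
    exact Prod.ext (Subtype.ext hy) rfl
  have hle := Nat.card_le_card_of_injective ψ hψ
  rw [Nat.card_prod, hA] at hle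
  have hq : 0 < Nat.card K := Nat.card_pos
  refine Nat.le_of_mul_le_mul_right ?_ hq
  calc Nat.card {y : V // B w y = κ ∧ B y y = 1} * Nat.card K ≤ Nat.card K ^ 3 := hle
    _ = Nat.card K ^ 2 * Nat.card K := by ring

/-- **Hyperplane sections with null normal through the origin.** If `⟨w, w⟩ = 0`, `w ≠ 0`,
then `{y : ⟨w, y⟩ = 0, ⟨y, y⟩ = 1}` has at most `q² + q` points: with a hyperbolic partner
`f` of `w` (`⟨f, f⟩ = 0`, `⟨w, f⟩ = 1`), `w^⊥ = K w ⊕ {w, f}^⊥` and `⟨t w + h, t w + h⟩ = ⟨h, h⟩`,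
so the section is `K ×` (a nonzero level set of the nondegenerate plane `{w, f}^⊥`), of size
`q (q ∓ 1)`. [folklore] -/
theorem natCard_section_le_of_null_zero [Finite K] [FiniteDimensional K V]
    (hB : B.Nondegenerate) (hBs : B.IsSymm) (h2 : (2 : K) ≠ 0) (h4 : finrank K V = 4) {w : V}
    (hw0 : w ≠ 0) (hw : B w w = 0) :
    Nat.card {y : V // B w y = 0 ∧ B y y = 1} ≤ Nat.card K ^ 2 + Nat.card K := by
  have : Finite V := Module.finite_of_finite K
  obtain ⟨f, hf, hwf⟩ := exists_hyperbolic_partner hB hBs h2 hw0 hw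
  have hfw : B f w = 1 := by rw [hBs.eq]; exact hwf
  -- the hyperbolic plane `H = span {w, f}` and its orthogonal complement `Hp`
  set H : Submodule K V := Submodule.span K ({w, f} : Set V) with hH
  have hind : ∀ c : K, f ≠ c • w := by
    intro c hc
    rw [hc, map_smul, smul_eq_mul, hw, mul_zero] at hwf
    exact zero_ne_one hwf
  have hH2 : finrank K H = 2 := finrank_span_pair_eq_two hw0 hind
  set Hp : Submodule K V := B.orthogonal H with hHp
  have hHp2 : finrank K Hp = 2 := by
    rw [hHp, LinearMap.BilinForm.finrank_orthogonal hB, h4, hH2]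
  have hmemHp : ∀ {v : V}, v ∈ Hp ↔ B w v = 0 ∧ B f v = 0 := by
    intro v
    rw [hHp, LinearMap.BilinForm.mem_orthogonal_iff]
    constructor
    · intro h
      exact ⟨h w (Submodule.subset_span (by simp)), h f (Submodule.subset_span (by simp))⟩
    · rintro ⟨h1, h1'⟩ n hn
      obtain ⟨a, b, rfl⟩ := Submodule.mem_span_pair.1 hn
      show B (a • w + b • f) v = 0
      rw [map_add, map_smul, map_smul, LinearMap.add_apply, LinearMap.smul_apply,
        LinearMap.smul_apply, smul_eq_mul, smul_eq_mul, h1, h1', mul_zero, mul_zero, add_zero]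
  -- `Hp` is a nondegenerate plane
  have hdisj : Disjoint H (B.orthogonal H) := by
    rw [Submodule.disjoint_def]
    intro v hvH hvHp
    obtain ⟨a, b, rfl⟩ := Submodule.mem_span_pair.1 hvH
    obtain ⟨h1, h1'⟩ := hmemHp.1 hvHp
    simp only [map_add, map_smul, smul_eq_mul, hw, hwf, hf, hfw, mul_zero, mul_one, zero_add,
      add_zero] at h1 h1'
    rw [h1, h1', zero_smul, zero_smul, add_zero]
  have hB' : (B.restrict Hp).Nondegenerate :=
    B.nondegenerate_restrict_of_disjoint_orthogonal hBs.isRefl (by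
      rw [hHp, LinearMap.BilinForm.orthogonal_orthogonal hB hBs.isRefl]
      exact hdisj.symm)
  have hBs' := isSymm_restrict hBs Hp
  -- the injection `y ↦ (⟨f, y⟩, y − ⟨f, y⟩ w)`
  have hmem : ∀ y : {y : V // B w y = 0 ∧ B y y = 1}, (y : V) - (B f y) • w ∈ Hp := by
    intro y
    refine hmemHp.2 ⟨?_, ?_⟩
    · rw [map_sub, map_smul, smul_eq_mul, y.2.1, hw, mul_zero, sub_zero]
    · rw [map_sub, map_smul, smul_eq_mul, hfw, mul_one, sub_self]
  let φ : {y : V // B w y = 0 ∧ B y y = 1} → K × {h : Hp // (B.restrict Hp) h h = 1} :=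
    fun y => (B f y, ⟨⟨(y : V) - (B f y) • w, hmem y⟩, by
      simp only [LinearMap.BilinForm.restrict_apply, LinearMap.domRestrict_apply]
      rw [apply_sub_smul_self hBs, y.2.2, y.2.1, hw]
      ring⟩)
  have hφ : Function.Injective φ := by
    intro y₁ y₂ h
    have ht : B f y₁ = B f y₂ := congrArg Prod.fst h
    have hv : (y₁ : V) - (B f y₁) • w = y₂ - (B f y₂) • w :=
      congrArg (fun z : K × {h : Hp // (B.restrict Hp) h h = 1} => ((z.2.1 : Hp) : V)) h
    rw [ht] at hv
    exact Subtype.ext (sub_left_injective hv)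
  have hle := Nat.card_le_card_of_injective φ hφ
  rw [Nat.card_prod] at hle
  have h1 : Nat.card {h : Hp // (B.restrict Hp) h h = 1} ≤ Nat.card K + 1 :=
    natCard_level_two_le hB' hBs' h2 hHp2 one_ne_zero
  calc Nat.card {y : V // B w y = 0 ∧ B y y = 1}
      ≤ Nat.card K * Nat.card {h : Hp // (B.restrict Hp) h h = 1} := hle
    _ ≤ Nat.card K * (Nat.card K + 1) := Nat.mul_le_mul_left _ h1
    _ = Nat.card K ^ 2 + Nat.card K := by ring

/-- **Every hyperplane section of the unit sphere has at most `q² + q` points:** for `w ≠ 0` and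
any `κ`, `|{y : ⟨w, y⟩ = κ, ⟨y, y⟩ = 1}| ≤ q² + q` (the three cases above; the bound is the
number of affine points of a hyperbolic quadric surface and is attained). [folklore] -/
theorem natCard_section_le [Finite K] [FiniteDimensional K V]
    (hB : B.Nondegenerate) (hBs : B.IsSymm) (h2 : (2 : K) ≠ 0) (h4 : finrank K V = 4) {w : V}
    (hw0 : w ≠ 0) (κ : K) :
    Nat.card {y : V // B w y = κ ∧ B y y = 1} ≤ Nat.card K ^ 2 + Nat.card K := by
  by_cases hw : B w w = 0
  · by_cases hκ : κ = 0
    · subst hκ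
      exact natCard_section_le_of_null_zero hB hBs h2 h4 hw0 hw
    · exact (natCard_section_le_of_null hB hBs h2 h4 hw0 hw hκ).trans (Nat.le_add_right _ _)
  · exact natCard_section_le_of_apply_self_ne_zero hB hBs h2 h4 hw κ

/-- **At most `q² + q` points of `P` on any affine `3`-space `x₀ + U`** (sharp form of
`ncard_translate_inter_sphere_le`): `x₀ + U` lies in the hyperplane `{⟨w, y⟩ = ⟨w, x₀⟩}` for a
normal vector `w` spanning `U^⊥`.
[cite: Tao2005FiniteFieldBesicovitch4D, Prop. 1.3, proof (§3, p. 342)] -/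
theorem ncard_translate_inter_sphere_le_sharp [Finite K] [FiniteDimensional K V]
    (hB : B.Nondegenerate) (hBs : B.IsSymm) (h2 : (2 : K) ≠ 0) (h4 : finrank K V = 4)
    {U : Submodule K V} (hU : finrank K U = 3) (x₀ : V) :
    (translate x₀ U ∩ sphere B).ncard ≤ Nat.card K ^ 2 + Nat.card K := by
  have : Finite V := Module.finite_of_finite K
  have hfin : finrank K (B.orthogonal U) = 1 := by
    rw [LinearMap.BilinForm.finrank_orthogonal hB, h4, hU]
  obtain ⟨w, hw0, -⟩ := finrank_eq_one_iff'.1 hfin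
  have hwU : ∀ u ∈ U, B u w = 0 := fun u hu => (LinearMap.BilinForm.mem_orthogonal_iff.1 w.2) u hu
  have hw0' : (w : V) ≠ 0 := fun h => hw0 (Subtype.ext h)
  let φ : (translate x₀ U ∩ sphere B : Set V) →
      {y : V // B (w : V) y = B (w : V) x₀ ∧ B y y = 1} :=
    fun y => ⟨y, by
      have h0 : B ((y : V) - x₀) w = 0 := hwU _ y.2.1
      rw [map_sub, LinearMap.sub_apply, sub_eq_zero] at h0
      rw [hBs.eq _ (y : V), hBs.eq _ x₀]
      exact h0, y.2.2⟩
  have hφ : Function.Injective φ := fun y₁ y₂ h => by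
    have h' := congrArg Subtype.val h
    exact Subtype.ext h'
  rw [← Nat.card_coe_set_eq]
  exact (Nat.card_le_card_of_injective φ hφ).trans (natCard_section_le hB hBs h2 h4 hw0' _)

end Section

section WolffSharp

/-- **At most one exceptional point:** two unit vectors `p₁, p₂ ∈ x₀ + U` with `U ⊆ p₁^⊥`,
`U ⊆ p₂^⊥` coincide (both lie on the line `U^⊥`, so `p₂ = c p₁`, and `p₂ − p₁ ∈ U ⊆ p₁^⊥` gives
`c = 1`). [folklore] -/
theorem exceptional_point_unique [FiniteDimensional K V] (hB : B.Nondegenerate)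
    (h4 : finrank K V = 4) {U : Submodule K V} (hU : finrank K U = 3) {x₀ p₁ p₂ : V}
    (hp₁S : p₁ ∈ translate x₀ U) (hp₂S : p₂ ∈ translate x₀ U) (hp₁ : B p₁ p₁ = 1)
    (hb₁ : ∀ u ∈ U, B u p₁ = 0) (hb₂ : ∀ u ∈ U, B u p₂ = 0) : p₁ = p₂ := by
  have hfin : finrank K (B.orthogonal U) = 1 := by
    rw [LinearMap.BilinForm.finrank_orthogonal hB, h4, hU]
  have hm₁ : p₁ ∈ B.orthogonal U := LinearMap.BilinForm.mem_orthogonal_iff.2 hb₁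
  have hm₂ : p₂ ∈ B.orthogonal U := LinearMap.BilinForm.mem_orthogonal_iff.2 hb₂
  have hp₁0 : (⟨p₁, hm₁⟩ : B.orthogonal U) ≠ 0 := by
    intro h
    have h' : p₁ = 0 := by simpa using congrArg Subtype.val h
    rw [h', map_zero] at hp₁
    exact absurd hp₁ zero_ne_one
  have hgen := (finrank_eq_one_iff_of_nonzero' _ hp₁0).1 hfin
  obtain ⟨c, hc⟩ := hgen ⟨p₂, hm₂⟩
  rw [Subtype.ext_iff] at hc
  simp only [SetLike.mk_smul_mk] at hc
  -- hc : c • p₁ = p₂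
  have hd : p₂ - p₁ ∈ U := by
    have h := U.sub_mem hp₂S hp₁S
    rwa [sub_sub_sub_cancel_right] at h
  have h0 := hb₁ _ hd
  rw [map_sub, LinearMap.sub_apply, ← hc, map_smul, LinearMap.smul_apply, smul_eq_mul, hp₁]
    at h0
  have hc1 : c = 1 := by linear_combination h0
  rw [← hc, hc1, one_smul]

/-- Through a point of `P` pass at most `q + 1` lines of `L` inside any set `S` (exactly `q + 1`
lines of `L` pass through it in all, `ncard_linesThrough`).
[cite: Tao2005FiniteFieldBesicovitch4D, Prop. 1.3, proof (§3, p. 342)] -/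
theorem ncard_linesThroughIn_le_card_add_one [Finite K] [FiniteDimensional K V]
    (hB : B.Nondegenerate) (hBs : B.IsSymm) (h2 : (2 : K) ≠ 0) (h4 : finrank K V = 4) {p : V}
    (hp : B p p = 1) (S : Set V) : (linesThroughIn B p S).ncard ≤ Nat.card K + 1 := by
  have : Finite V := Module.finite_of_finite K
  rw [← ncard_linesThrough hB hBs h2 h4 (x := p) hp]
  exact Set.ncard_le_ncard (fun ℓ hℓ => ⟨hℓ.1, Set.subset_univ _, hℓ.2.2⟩) (Set.toFinite _)

/-- **The Wolff axiom for `k = 3` with the sharp constant: every affine `3`-space `x₀ + U`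
(`finrank U = 3`) contains at most `2 (q + 1)` lines of `L`**, for every nondegenerate symmetric
form on a `4`-space over `𝔽_q`, `q` odd (Tao: "at most `O(|F|)`", p. 342; `2 (q + 1)` is the number
of lines on a hyperbolic quadric surface, cf. `Tao2005Quadric.ncard_linesInZIn_space_le_sharp`
for the split form).  Double count of incidences in `x₀ + U`: at most two lines through each
point of `P ∩ (x₀ + U)` except at the (at most one) point `p` with `U ⊆ p^⊥`, through which at
most `q + 1` lines pass, and `|P ∩ (x₀ + U)| ≤ q² + q`; so
`q · #lines ≤ 2 (q² + q) + (q − 1) < q (2q + 3)`.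
[cite: Tao2005FiniteFieldBesicovitch4D, Prop. 1.3, proof (§3, p. 342)] -/
theorem ncard_lineSetIn_le_sharp [Finite K] [FiniteDimensional K V] (hB : B.Nondegenerate)
    (hBs : B.IsSymm) (h2 : (2 : K) ≠ 0) (h4 : finrank K V = 4) {U : Submodule K V}
    (hU : finrank K U = 3) (x₀ : V) :
    (lineSetIn B (translate x₀ U)).ncard ≤ 2 * (Nat.card K + 1) := by
  classical
  have : Finite V := Module.finite_of_finite K
  set S := translate x₀ U with hSdef
  haveI : Fintype (S ∩ sphere B : Set V) := Fintype.ofFinite _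
  have hcount : (lineSetIn B S).ncard * Nat.card K =
      ∑ p : (S ∩ sphere B : Set V), (linesThroughIn B (p : V) S).ncard := by
    rw [← natCard_incidence S, ← Nat.card_congr (incidenceEquivIn hBs S), Nat.card_sigma]
    simp only [Nat.card_coe_set_eq]
  let bad : (S ∩ sphere B : Set V) → Prop := fun p => ∀ u ∈ U, B u p = 0
  let m : (S ∩ sphere B : Set V) → ℕ := fun p => (linesThroughIn B (p : V) S).ncard
  have hbad_card : (Finset.univ.filter bad).card ≤ 1 := by
    rw [Finset.card_le_one]
    intro a ha b hb
    simp only [Finset.mem_filter, Finset.mem_univ, true_and] at ha hb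
    exact Subtype.ext (exceptional_point_unique hB h4 hU a.2.1 b.2.1 a.2.2 ha hb)
  have hbad_sum : ∑ p ∈ Finset.univ.filter bad, m p ≤
      (Finset.univ.filter bad).card • (Nat.card K + 1) :=
    Finset.sum_le_card_nsmul _ _ _
      (fun p _ => ncard_linesThroughIn_le_card_add_one hB hBs h2 h4 p.2.2 S)
  have hgood_sum : ∑ p ∈ Finset.univ.filter (fun p => ¬ bad p), m p ≤
      (Finset.univ.filter (fun p => ¬ bad p)).card • 2 :=
    Finset.sum_le_card_nsmul _ _ _ (fun p hp => by
      simp only [Finset.mem_filter, Finset.mem_univ, true_and, bad] at hp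
      push Not at hp
      exact ncard_linesThroughIn_le_two hB hBs h2 h4 hU hp)
  have htot : (Finset.univ.filter bad).card + (Finset.univ.filter (fun p => ¬ bad p)).card ≤
      Nat.card K ^ 2 + Nat.card K := by
    rw [Finset.card_filter_add_card_filter_not, Finset.card_univ,
      ← Nat.card_eq_fintype_card, Nat.card_coe_set_eq]
    exact ncard_translate_inter_sphere_le_sharp hB hBs h2 h4 hU x₀
  have hq3 := two_lt_card (K := K) h2
  have hsum : ∑ p, m p + 1 ≤ 2 * (Nat.card K ^ 2 + Nat.card K) + Nat.card K := by
    rw [← Finset.sum_filter_add_sum_filter_not Finset.univ bad m]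
    have h := add_le_add hbad_sum hgood_sum
    rw [smul_eq_mul, smul_eq_mul] at h
    nlinarith [h, hbad_card, htot, hq3]
  have key : (lineSetIn B S).ncard * Nat.card K < (2 * (Nat.card K + 1) + 1) * Nat.card K := by
    rw [hcount]
    nlinarith [hsum, hq3]
  have hlt := Nat.lt_of_mul_lt_mul_right key
  omega

/-- **The Wolff axiom (Tao's Definition 1.1, `n = 4`) for `L` with sharp constants, general
nondegenerate form:** every affine `2`-plane contains at most `2` lines of `L` and every affine
`3`-space at most `2 (q + 1)` (`K = 𝔽_q`, `q` odd).
[cite: Tao2005FiniteFieldBesicovitch4D, Prop. 1.3 (§1, p. 338)] -/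
theorem wolffAxiom_sharp [Finite K] [FiniteDimensional K V] (hB : B.Nondegenerate)
    (hBs : B.IsSymm) (h2 : (2 : K) ≠ 0) (h4 : finrank K V = 4) :
    (∀ (W : Submodule K V) (x₀ : V), finrank K W = 2 →
        (lineSetIn B (translate x₀ W)).ncard ≤ 2) ∧
      ∀ (U : Submodule K V) (x₀ : V), finrank K U = 3 →
        (lineSetIn B (translate x₀ U)).ncard ≤ 2 * (Nat.card K + 1) :=
  ⟨fun _ x₀ hW => ncard_lineSetIn_plane_le_two hB hBs h2 h4 hW x₀,
    fun _ x₀ hU => ncard_lineSetIn_le_sharp hB hBs h2 h4 hU x₀⟩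

/-- `wolffAxiom_sharp` on `F⁴ = Fin 4 → K` literally.
[cite: Tao2005FiniteFieldBesicovitch4D, Prop. 1.3 (§1, p. 338)] -/
theorem wolffAxiom_sharp_fin [Finite K] {B : LinearMap.BilinForm K (Fin 4 → K)}
    (hB : B.Nondegenerate) (hBs : B.IsSymm) (h2 : (2 : K) ≠ 0) :
    (∀ (W : Submodule K (Fin 4 → K)) (x₀ : Fin 4 → K), finrank K W = 2 →
        (lineSetIn B (translate x₀ W)).ncard ≤ 2) ∧
      ∀ (U : Submodule K (Fin 4 → K)) (x₀ : Fin 4 → K), finrank K U = 3 →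
        (lineSetIn B (translate x₀ U)).ncard ≤ 2 * (Nat.card K + 1) :=
  wolffAxiom_sharp hB hBs h2 (Module.finrank_fin_fun K)

end WolffSharp

section SharpCapstone

variable [Finite K] [FiniteDimensional K V]

/-- **Proposition 1.3 with every constant sharp or exact.**  Let `K = 𝔽_q` with `q` odd, `V` a
`4`-dimensional `K`-space, `B = ⟨ , ⟩` nondegenerate symmetric, `P = {⟨x, x⟩ = 1}`, `L` Tao's
line family.  Then: `P` contains all the lines of `L`; `|P| = q³ − q` or `|P| = q³ + q` and
`|L| · q = |P| · (q + 1)` (Tao: `|P| ∼ |F|³`, `|L| ∼ |F|³`; `Tao2005UnitSphereCounts`); every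
affine `2`-plane contains at most `2` lines of `L`; every affine `3`-space `x₀ + U` contains at
most `q² + q` points of `P` and at most `2 (q + 1)` lines of `L` (Tao: the Wolff axiom,
`O(|F|^{k−1})` lines in a `k`-space, proved with `O(|F|)` for `k = 2, 3`).
[cite: Tao2005FiniteFieldBesicovitch4D, Prop. 1.3 (§1, p. 338)] -/
theorem prop13_sharp (hB : B.Nondegenerate) (hBs : B.IsSymm) (h2 : (2 : K) ≠ 0)
    (h4 : finrank K V = 4) :
    (∀ ℓ ∈ lineSet B, ℓ ⊆ sphere B) ∧
      ((sphere B).ncard = Nat.card K ^ 3 - Nat.card K ∨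
        (sphere B).ncard = Nat.card K ^ 3 + Nat.card K) ∧
      (lineSet B).ncard * Nat.card K = (sphere B).ncard * (Nat.card K + 1) ∧
      (∀ (W : Submodule K V) (x₀ : V), finrank K W = 2 →
        (lineSetIn B (translate x₀ W)).ncard ≤ 2) ∧
      ∀ (U : Submodule K V) (x₀ : V), finrank K U = 3 →
        (translate x₀ U ∩ sphere B).ncard ≤ Nat.card K ^ 2 + Nat.card K ∧
          (lineSetIn B (translate x₀ U)).ncard ≤ 2 * (Nat.card K + 1) :=
  ⟨fun _ hℓ => subset_sphere_of_mem_lineSet hBs hℓ, ncard_sphere_eq_or hB hBs h2 h4,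
    ncard_lineSet_mul_card hB hBs h2 h4,
    fun _ x₀ hW => ncard_lineSetIn_plane_le_two hB hBs h2 h4 hW x₀,
    fun _ x₀ hU => ⟨ncard_translate_inter_sphere_le_sharp hB hBs h2 h4 hU x₀,
      ncard_lineSetIn_le_sharp hB hBs h2 h4 hU x₀⟩⟩

/-- **Proposition 1.3 with every constant sharp or exact, on `F⁴ = Fin 4 → K`.**
[cite: Tao2005FiniteFieldBesicovitch4D, Prop. 1.3 (§1, p. 338)] -/
theorem prop13_sharp_fin {B : LinearMap.BilinForm K (Fin 4 → K)} (hB : B.Nondegenerate)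
    (hBs : B.IsSymm) (h2 : (2 : K) ≠ 0) :
    (∀ ℓ ∈ lineSet B, ℓ ⊆ sphere B) ∧
      ((sphere B).ncard = Nat.card K ^ 3 - Nat.card K ∨
        (sphere B).ncard = Nat.card K ^ 3 + Nat.card K) ∧
      (lineSet B).ncard * Nat.card K = (sphere B).ncard * (Nat.card K + 1) ∧
      (∀ (W : Submodule K (Fin 4 → K)) (x₀ : Fin 4 → K), finrank K W = 2 →
        (lineSetIn B (translate x₀ W)).ncard ≤ 2) ∧
      ∀ (U : Submodule K (Fin 4 → K)) (x₀ : Fin 4 → K), finrank K U = 3 →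
        (translate x₀ U ∩ sphere B).ncard ≤ Nat.card K ^ 2 + Nat.card K ∧
          (lineSetIn B (translate x₀ U)).ncard ≤ 2 * (Nat.card K + 1) :=
  prop13_sharp hB hBs h2 (Module.finrank_fin_fun K)

end SharpCapstone

section Attained

/-! ### The bounds are attained: a hyperbolic section

For a hyperbolic pair `e, f` and a unit vector `g ∈ {e, f}^⊥` the `3`-space `U = span {e, f, g}`
carries the form `⟨a e + b f + c g, a e + b f + c g⟩ = 2ab + c²`; its unit sphere
`{2ab + c² = 1}` contains the `2 (q + 1)` lines `{λ e + σ g + t (−λ² e + 2 f − 2 σ λ g)}`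
(`σ = ±1`, `λ ∈ K`) and `{σ g + t e}` (`σ = ±1`) — the two rulings of the hyperbolic quadric
`2ab = (1 − c)(1 + c)` — and has exactly `q² + q` points. -/

/-- **The orthogonal complement of a hyperbolic pair** `e, f` (`⟨e, e⟩ = ⟨f, f⟩ = 0`,
`⟨e, f⟩ = 1`) in a nondegenerate `4`-space: `{e, f}^⊥ = {v : ⟨e, v⟩ = ⟨f, v⟩ = 0}` is a
nondegenerate plane (the hyperbolic plane `span {e, f}` meets it trivially). [folklore] -/
theorem orthogonal_hyperbolic_pair [FiniteDimensional K V] (hB : B.Nondegenerate)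
    (hBs : B.IsSymm) (h4 : finrank K V = 4) {e f : V} (he : B e e = 0) (hf : B f f = 0)
    (hef : B e f = 1) :
    finrank K (B.orthogonal (Submodule.span K ({e, f} : Set V))) = 2 ∧
      (B.restrict (B.orthogonal (Submodule.span K ({e, f} : Set V)))).Nondegenerate ∧
      ∀ v : V, v ∈ B.orthogonal (Submodule.span K ({e, f} : Set V)) ↔ B e v = 0 ∧ B f v = 0 := by
  have hfe : B f e = 1 := by rw [hBs.eq]; exact hef
  have he0 : e ≠ 0 := by
    intro h
    rw [h, map_zero] at hfe
    exact zero_ne_one hfe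
  set H : Submodule K V := Submodule.span K ({e, f} : Set V) with hH
  have hind : ∀ c : K, f ≠ c • e := by
    intro c hc
    rw [hc, map_smul, smul_eq_mul, he, mul_zero] at hef
    exact zero_ne_one hef
  have hH2 : finrank K H = 2 := finrank_span_pair_eq_two he0 hind
  have hmem : ∀ v : V, v ∈ B.orthogonal H ↔ B e v = 0 ∧ B f v = 0 := by
    intro v
    rw [LinearMap.BilinForm.mem_orthogonal_iff]
    constructor
    · intro h
      exact ⟨h e (Submodule.subset_span (by simp)), h f (Submodule.subset_span (by simp))⟩
    · rintro ⟨h1, h1'⟩ n hn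
      obtain ⟨a, b, rfl⟩ := Submodule.mem_span_pair.1 hn
      show B (a • e + b • f) v = 0
      rw [map_add, map_smul, map_smul, LinearMap.add_apply, LinearMap.smul_apply,
        LinearMap.smul_apply, smul_eq_mul, smul_eq_mul, h1, h1', mul_zero, mul_zero, add_zero]
  have hdisj : Disjoint H (B.orthogonal H) := by
    rw [Submodule.disjoint_def]
    intro v hvH hvHp
    obtain ⟨a, b, rfl⟩ := Submodule.mem_span_pair.1 hvH
    obtain ⟨h1, h1'⟩ := (hmem _).1 hvHp
    simp only [map_add, map_smul, smul_eq_mul, he, hef, hf, hfe, mul_zero, mul_one, zero_add,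
      add_zero] at h1 h1'
    rw [h1, h1', zero_smul, zero_smul, add_zero]
  refine ⟨by rw [LinearMap.BilinForm.finrank_orthogonal hB, h4, hH2], ?_, hmem⟩
  exact B.nondegenerate_restrict_of_disjoint_orthogonal hBs.isRefl (by
    rw [LinearMap.BilinForm.orthogonal_orthogonal hB hBs.isRefl]
    exact hdisj.symm)

variable {e f g : V}

/-- The form on the frame `e, f, g` (`⟨e,e⟩ = ⟨f,f⟩ = 0`, `⟨e,f⟩ = 1`, `g ⊥ e, f`, `⟨g,g⟩ = 1`):
`⟨a e + b f + c g, a' e + b' f + c' g⟩ = a b' + b a' + c c'`. [folklore] -/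
theorem apply_frame (hBs : B.IsSymm) (he : B e e = 0) (hf : B f f = 0) (hef : B e f = 1)
    (heg : B e g = 0) (hfg : B f g = 0) (hg : B g g = 1) (a b c a' b' c' : K) :
    B (a • e + b • f + c • g) (a' • e + b' • f + c' • g) = a * b' + b * a' + c * c' := by
  have hfe : B f e = 1 := by rw [hBs.eq]; exact hef
  have hge : B g e = 0 := by rw [hBs.eq]; exact heg
  have hgf : B g f = 0 := by rw [hBs.eq]; exact hfg
  simp only [map_add, map_smul, LinearMap.add_apply, LinearMap.smul_apply, smul_eq_mul, he, hf,
    hef, hfe, heg, hge, hfg, hgf, hg]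
  ring

/-- Coordinates on the frame are unique: comparing `x' = x + s v` coordinatewise (apply
`⟨·, f⟩`, `⟨·, e⟩`, `⟨·, g⟩`). [folklore] -/
theorem frame_coords_of_eq_add_smul (hBs : B.IsSymm) (he : B e e = 0) (hf : B f f = 0)
    (hef : B e f = 1) (heg : B e g = 0) (hfg : B f g = 0) (hg : B g g = 1)
    {a b c a' b' c' a'' b'' c'' s : K}
    (h : a' • e + b' • f + c' • g = a • e + b • f + c • g + s • (a'' • e + b'' • f + c'' • g)) :
    a' = a + s * a'' ∧ b' = b + s * b'' ∧ c' = c + s * c'' := by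
  have hfe : B f e = 1 := by rw [hBs.eq]; exact hef
  have hge : B g e = 0 := by rw [hBs.eq]; exact heg
  have hgf : B g f = 0 := by rw [hBs.eq]; exact hfg
  have h1 := congrArg (fun z => B z f) h
  have h2' := congrArg (fun z => B z e) h
  have h3 := congrArg (fun z => B z g) h
  simp only [map_add, map_smul, LinearMap.add_apply, LinearMap.smul_apply, smul_eq_mul, he, hf,
    hef, hfe, heg, hge, hfg, hgf, hg, mul_zero, mul_one, zero_add, add_zero] at h1 h2' h3
  exact ⟨by linear_combination h1, by linear_combination h2', by linear_combination h3⟩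

/-- Coordinates on the frame are unique: comparing `v' = μ v` coordinatewise. [folklore] -/
theorem frame_coords_of_eq_smul (hBs : B.IsSymm) (he : B e e = 0) (hf : B f f = 0)
    (hef : B e f = 1) (heg : B e g = 0) (hfg : B f g = 0) (hg : B g g = 1)
    {a b c a' b' c' μ : K} (h : a' • e + b' • f + c' • g = μ • (a • e + b • f + c • g)) :
    a' = μ * a ∧ b' = μ * b ∧ c' = μ * c := by
  have hfe : B f e = 1 := by rw [hBs.eq]; exact hef
  have hge : B g e = 0 := by rw [hBs.eq]; exact heg
  have hgf : B g f = 0 := by rw [hBs.eq]; exact hfg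
  have h1 := congrArg (fun z => B z f) h
  have h2' := congrArg (fun z => B z e) h
  have h3 := congrArg (fun z => B z g) h
  simp only [map_add, map_smul, LinearMap.add_apply, LinearMap.smul_apply, smul_eq_mul, he, hf,
    hef, hfe, heg, hge, hfg, hgf, hg, mul_zero, mul_one, zero_add, add_zero] at h1 h2' h3
  exact ⟨by linear_combination h1, by linear_combination h2', by linear_combination h3⟩

/-- Membership in the `3`-space `span {e, f} + K g` of the frame. [folklore] -/
theorem mem_frame_iff {u : V} :
    u ∈ Submodule.span K ({e, f} : Set V) ⊔ (K ∙ g) ↔ ∃ a b c : K, a • e + b • f + c • g = u := by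
  rw [Submodule.mem_sup]
  constructor
  · rintro ⟨y, hy, z, hz, rfl⟩
    obtain ⟨a, b, rfl⟩ := Submodule.mem_span_pair.1 hy
    obtain ⟨c, rfl⟩ := Submodule.mem_span_singleton.1 hz
    exact ⟨a, b, c, rfl⟩
  · rintro ⟨a, b, c, rfl⟩
    exact ⟨a • e + b • f, Submodule.mem_span_pair.2 ⟨a, b, rfl⟩, c • g,
      Submodule.mem_span_singleton.2 ⟨c, rfl⟩, rfl⟩

/-- The `3`-space of the frame has dimension `3`. [folklore] -/
theorem finrank_frame [FiniteDimensional K V] (he : B e e = 0) (hef : B e f = 1)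
    (heg : B e g = 0) (hfg : B f g = 0) (hg : B g g = 1) :
    finrank K ↥(Submodule.span K ({e, f} : Set V) ⊔ (K ∙ g)) = 3 := by
  have he0 : e ≠ 0 := by
    intro h
    rw [h, LinearMap.map_zero, LinearMap.zero_apply] at hef
    exact zero_ne_one hef
  have hind : ∀ c : K, f ≠ c • e := by
    intro c hc
    rw [hc, map_smul, smul_eq_mul, he, mul_zero] at hef
    exact zero_ne_one hef
  have hH2 : finrank K (Submodule.span K ({e, f} : Set V)) = 2 := finrank_span_pair_eq_two he0 hind
  have hg0 : g ≠ 0 := ne_zero_of_apply_self_ne_zero (B := B) (by rw [hg]; exact one_ne_zero)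
  have hG1 : finrank K (K ∙ g) = 1 := finrank_span_singleton hg0
  have hinf : Submodule.span K ({e, f} : Set V) ⊓ (K ∙ g) = ⊥ := by
    rw [eq_bot_iff]
    intro v hv
    obtain ⟨hvH, hvG⟩ := Submodule.mem_inf.1 hv
    obtain ⟨c, rfl⟩ := Submodule.mem_span_singleton.1 hvG
    obtain ⟨a, b, hab⟩ := Submodule.mem_span_pair.1 hvH
    have hc : c = 0 := by
      have h := congrArg (fun z => B z g) hab
      simp only [map_add, map_smul, LinearMap.add_apply, LinearMap.smul_apply, smul_eq_mul, heg,
        hfg, hg, mul_zero, add_zero, mul_one] at h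
      exact h.symm
    rw [hc, zero_smul]
    exact Submodule.zero_mem _
  have h := Submodule.finrank_sup_add_finrank_inf_eq (Submodule.span K ({e, f} : Set V)) (K ∙ g)
  rw [hinf, finrank_bot, hH2, hG1] at h
  omega

/-- Two presentations of one line: the base points differ by a multiple of the direction and the
directions are proportional. [folklore] -/
theorem exists_of_line_eq {x v x' v' : V} (h : line K x v = line K x' v') :
    ∃ s μ : K, x' = x + s • v ∧ v' = μ • v := by
  have hx' : x' ∈ line K x v := by rw [h]; exact mem_line_self x' v'
  have hxv' : x' + v' ∈ line K x v := by rw [h]; exact add_mem_line x' v'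
  obtain ⟨s, hs⟩ := hx'
  obtain ⟨s', hs'⟩ := hxv'
  dsimp only at hs hs'
  refine ⟨s, s' - s, hs.symm, ?_⟩
  calc v' = (x' + v') - x' := by abel
    _ = (x + s' • v) - (x + s • v) := by rw [hs', hs]
    _ = (s' - s) • v := by rw [sub_smul]; abel

/-- **A `3`-space with exactly `2 (q + 1)` lines of `L`** (frame `e, f, g` as above,
`U = span {e, f} + K g`): the `2 (q + 1)` lines `{λ e + σ g + t (−λ² e + 2 f − 2 σ λ g)}` and
`{σ g + t e}` (`σ = ±1`, `λ ∈ K`) belong to `L`, lie in `U` and are pairwise distinct; equality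
by `ncard_lineSetIn_le_sharp`.  So the constant `2 (q + 1)` is attained for every nondegenerate
form. [folklore] -/
theorem ncard_lineSetIn_frame [Finite K] [FiniteDimensional K V] (hB : B.Nondegenerate)
    (hBs : B.IsSymm) (h2 : (2 : K) ≠ 0) (h4 : finrank K V = 4) (he : B e e = 0) (hf : B f f = 0)
    (hef : B e f = 1) (heg : B e g = 0) (hfg : B f g = 0) (hg : B g g = 1) :
    (lineSetIn B (translate (0 : V) (Submodule.span K ({e, f} : Set V) ⊔ (K ∙ g)))).ncard =
      2 * (Nat.card K + 1) := by
  classical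
  have : Finite V := Module.finite_of_finite K
  set U : Submodule K V := Submodule.span K ({e, f} : Set V) ⊔ (K ∙ g) with hU
  have hU3 : finrank K U = 3 := finrank_frame he hef heg hfg hg
  apply le_antisymm (ncard_lineSetIn_le_sharp hB hBs h2 h4 hU3 0)
  -- frame combinations lie in `translate 0 U`
  have hmemU : ∀ a b c : K, a • e + b • f + c • g ∈ translate (0 : V) U := fun a b c => by
    rw [mem_translate_iff, sub_zero]
    exact mem_frame_iff.2 ⟨a, b, c, rfl⟩
  -- a frame combination with a nonzero `e`- or `f`-coordinate is nonzero
  have hne : ∀ a b c : K, a ≠ 0 ∨ b ≠ 0 → a • e + b • f + c • g ≠ 0 := by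
    intro a b c hab h0
    have h0' : a • e + b • f + c • g = (0 : K) • ((0 : K) • e + (0 : K) • f + (0 : K) • g) := by
      rw [h0, zero_smul]
    obtain ⟨ha, hb, -⟩ := frame_coords_of_eq_smul hBs he hf hef heg hfg hg h0'
    rw [zero_mul] at ha hb
    rcases hab with ha0 | hb0
    · exact ha0 ha
    · exact hb0 hb
  -- the sign `σ = ±1`
  let σ : Bool → K := fun b => if b then 1 else -1
  have hσ2 : ∀ b, σ b * σ b = 1 := fun b => by cases b <;> simp [σ]
  have hσinj : ∀ b b', σ b = σ b' → b = b' := by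
    intro b b' h
    cases b <;> cases b' <;> simp [σ] at h ⊢
    · have h' : (2 : K) = 0 := by linear_combination -h
      exact h2 h'
    · have h' : (2 : K) = 0 := by linear_combination h
      exact h2 h'
  -- the two families of lines, as members of `lineSetIn B (translate 0 U)`
  let Φ₁ : Bool × K → lineSetIn B (translate (0 : V) U) := fun p =>
    ⟨line K (p.2 • e + (0 : K) • f + σ p.1 • g)
        ((-(p.2 ^ 2)) • e + (2 : K) • f + (-(2 * σ p.1 * p.2)) • g), by
      refine ⟨⟨_, _, hne _ _ _ (Or.inr h2), ?_, ?_, ?_, rfl⟩,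
        line_subset_translate (hmemU _ _ _) (mem_frame_iff.2 ⟨_, _, _, rfl⟩)⟩
      · rw [apply_frame hBs he hf hef heg hfg hg]
        linear_combination hσ2 p.1
      · rw [apply_frame hBs he hf hef heg hfg hg]
        linear_combination (-(2 * p.2)) * hσ2 p.1
      · rw [apply_frame hBs he hf hef heg hfg hg]
        linear_combination (4 * p.2 ^ 2) * hσ2 p.1⟩
  let Φ₂ : Bool → lineSetIn B (translate (0 : V) U) := fun b =>
    ⟨line K ((0 : K) • e + (0 : K) • f + σ b • g) ((1 : K) • e + (0 : K) • f + (0 : K) • g), by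
      refine ⟨⟨_, _, hne _ _ _ (Or.inl one_ne_zero), ?_, ?_, ?_, rfl⟩,
        line_subset_translate (hmemU _ _ _) (mem_frame_iff.2 ⟨_, _, _, rfl⟩)⟩
      · rw [apply_frame hBs he hf hef heg hfg hg]
        linear_combination hσ2 b
      · rw [apply_frame hBs he hf hef heg hfg hg]
        ring
      · rw [apply_frame hBs he hf hef heg hfg hg]
        ring⟩
  -- injectivity, through the frame coordinates
  have hΦ₁ : Function.Injective Φ₁ := by
    intro p p' h
    have h' := congrArg (fun z : lineSetIn B (translate (0 : V) U) => (z : Set V)) h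
    obtain ⟨s, μ, hx, -⟩ := exists_of_line_eq h'
    obtain ⟨ha', hb', hc'⟩ := frame_coords_of_eq_add_smul hBs he hf hef heg hfg hg hx
    -- `hb' : 0 = 0 + s * 2`, `ha' : p'.2 = p.2 + s * _`, `hc' : σ p'.1 = σ p.1 + s * _`
    have hs : s = 0 := by
      have h0 : s * 2 = 0 := by linear_combination -hb'
      exact (mul_eq_zero.1 h0).resolve_right h2
    rw [hs, zero_mul, add_zero] at ha' hc'
    exact Prod.ext (hσinj _ _ hc').symm ha'.symm
  have hΦ₂ : Function.Injective Φ₂ := by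
    intro b b' h
    have h' := congrArg (fun z : lineSetIn B (translate (0 : V) U) => (z : Set V)) h
    obtain ⟨s, μ, hx, -⟩ := exists_of_line_eq h'
    obtain ⟨-, -, hc'⟩ := frame_coords_of_eq_add_smul hBs he hf hef heg hfg hg hx
    rw [mul_zero, add_zero] at hc'
    exact (hσinj _ _ hc').symm
  have hΦ₁₂ : ∀ p b, Φ₁ p ≠ Φ₂ b := by
    intro p b h
    have h' := congrArg (fun z : lineSetIn B (translate (0 : V) U) => (z : Set V)) h
    obtain ⟨s, μ, -, hv⟩ := exists_of_line_eq h'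
    obtain ⟨ha, hb, -⟩ := frame_coords_of_eq_smul hBs he hf hef heg hfg hg hv
    -- `hb : 0 = μ * 2`, `ha : 1 = μ * (-(p.2 ^ 2))`
    have hμ : μ = 0 := by
      have h0 : μ * 2 = 0 := hb.symm
      exact (mul_eq_zero.1 h0).resolve_right h2
    rw [hμ, zero_mul] at ha
    exact one_ne_zero ha
  have hinj : Function.Injective (Sum.elim Φ₁ Φ₂) := hΦ₁.sumElim hΦ₂ hΦ₁₂
  have hle := Nat.card_le_card_of_injective _ hinj
  rw [Nat.card_sum, Nat.card_prod, Nat.card_eq_fintype_card (α := Bool), Fintype.card_bool]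
    at hle
  rw [← Nat.card_coe_set_eq]
  linarith

/-- **The frame `3`-space meets `P` in exactly `q² + q` points** (`#{2ab + c² = 1} = q² + q`:
the ternary form `2ab + c²` is nondegenerate with the isotropic plane `span {e, f} ⊥ g`, so
`Tao2005UnitSphereCounts.natCard_level_three_of_isotropic` gives `q² − q + q · #{s : s² = 1}`).
So the point bound `q² + q` is attained for every nondegenerate form. [folklore] -/
theorem ncard_translate_inter_sphere_frame [Finite K] [FiniteDimensional K V]
    (hBs : B.IsSymm) (h2 : (2 : K) ≠ 0) (he : B e e = 0) (hf : B f f = 0) (hef : B e f = 1)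
    (heg : B e g = 0) (hfg : B f g = 0) (hg : B g g = 1) :
    (translate (0 : V) (Submodule.span K ({e, f} : Set V) ⊔ (K ∙ g)) ∩ sphere B).ncard =
      Nat.card K ^ 2 + Nat.card K := by
  classical
  have : Finite V := Module.finite_of_finite K
  set U : Submodule K V := Submodule.span K ({e, f} : Set V) ⊔ (K ∙ g) with hU
  have hU3 : finrank K U = 3 := finrank_frame he hef heg hfg hg
  have heU : e ∈ U := mem_frame_iff.2 ⟨1, 0, 0, by simp⟩
  have hfU : f ∈ U := mem_frame_iff.2 ⟨0, 1, 0, by simp⟩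
  have hgU : g ∈ U := mem_frame_iff.2 ⟨0, 0, 1, by simp⟩
  have hfe : B f e = 1 := by rw [hBs.eq]; exact hef
  have hge : B g e = 0 := by rw [hBs.eq]; exact heg
  have hgf : B g f = 0 := by rw [hBs.eq]; exact hfg
  have he0 : e ≠ 0 := by
    intro h
    rw [h, map_zero] at hfe
    exact zero_ne_one hfe
  -- `B` restricted to `U` is nondegenerate
  have hB' : (B.restrict U).Nondegenerate := by
    refine B.nondegenerate_restrict_of_disjoint_orthogonal hBs.isRefl ?_
    rw [Submodule.disjoint_def]
    intro v hvU hvp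
    obtain ⟨a, b, c, rfl⟩ := mem_frame_iff.1 hvU
    rw [LinearMap.BilinForm.mem_orthogonal_iff] at hvp
    have h1 : B e (a • e + b • f + c • g) = 0 := hvp e heU
    have h1' : B f (a • e + b • f + c • g) = 0 := hvp f hfU
    have h3 : B g (a • e + b • f + c • g) = 0 := hvp g hgU
    simp only [map_add, map_smul, smul_eq_mul, he, hf, hef, hfe, heg, hge, hfg, hgf, hg, mul_zero,
      mul_one, zero_add, add_zero] at h1 h1' h3
    rw [h1, h1', h3, zero_smul, zero_smul, zero_smul, add_zero, add_zero]
  have hBs' := isSymm_restrict hBs U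
  -- the unit vector `g` of `U`, with the null vector `e ⊥ g`
  have hg' : (B.restrict U) ⟨g, hgU⟩ ⟨g, hgU⟩ = 1 := by
    simp only [LinearMap.BilinForm.restrict_apply, LinearMap.domRestrict_apply]
    exact hg
  have hgu : (B.restrict U) ⟨g, hgU⟩ ⟨g, hgU⟩ ≠ 0 := by rw [hg']; exact one_ne_zero
  have hiso : ∃ w ∈ (B.restrict U).orthogonal (K ∙ (⟨g, hgU⟩ : U)),
      w ≠ 0 ∧ (B.restrict U) w w = 0 := by
    refine ⟨⟨e, heU⟩, ?_, fun h0 => he0 (congrArg Subtype.val h0), ?_⟩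
    · rw [mem_orthogonal_span_singleton_iff hBs']
      simp only [LinearMap.BilinForm.restrict_apply, LinearMap.domRestrict_apply]
      exact heg
    · simp only [LinearMap.BilinForm.restrict_apply, LinearMap.domRestrict_apply]
      exact he
  have hcount := natCard_level_three_of_isotropic hB' hBs' h2 hU3 hgu hiso 1
  rw [hg'] at hcount
  -- `#{s : s² = 1} = 2`
  have htwo : Nat.card {s : K // (1 : K) * s ^ 2 = 1} = 2 := by
    have hneg : (-1 : K) ≠ 1 := fun h => h2 (by linear_combination -h)
    rw [Nat.card_eq_two_iff]
    refine ⟨⟨1, by ring⟩, ⟨-1, by ring⟩, fun h => hneg.symm (congrArg Subtype.val h), ?_⟩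
    ext ⟨s, hs⟩
    simp only [Set.mem_insert_iff, Set.mem_singleton_iff, Set.mem_univ, iff_true, Subtype.mk.injEq]
    have hs' : (s - 1) * (s + 1) = 0 := by linear_combination hs
    rcases mul_eq_zero.1 hs' with h | h
    · exact Or.inl (by linear_combination h)
    · exact Or.inr (by linear_combination h)
  rw [htwo] at hcount
  -- the section is the level set `{⟨u, u⟩ = 1}` of `U`
  have hequiv : (translate (0 : V) U ∩ sphere B : Set V) ≃ {v : U // (B.restrict U) v v = 1} :=
    { toFun := fun y => ⟨⟨y.1, by
          have h := y.2.1
          rwa [mem_translate_iff, sub_zero] at h⟩, by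
          simp only [LinearMap.BilinForm.restrict_apply, LinearMap.domRestrict_apply]
          exact y.2.2⟩
      invFun := fun v => ⟨v.1, by rw [mem_translate_iff, sub_zero]; exact v.1.2, by
          have h := v.2
          simp only [LinearMap.BilinForm.restrict_apply, LinearMap.domRestrict_apply] at h
          exact h⟩
      left_inv := fun y => rfl
      right_inv := fun v => rfl }
  rw [← Nat.card_coe_set_eq, Nat.card_congr hequiv]
  linarith

/-- **A hyperbolic frame exists for every nondegenerate form** on a `4`-space over `𝔽_q` (`q`
odd): a hyperbolic pair `e, f` (`Tao2005UnitSphereCounts.exists_null_ne_zero`,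
`exists_hyperbolic_partner`) and a unit vector `g` of the nondegenerate plane `{e, f}^⊥` (which
represents `1`: `Tao2005UnitSphere.card_le_natCard_level_two`). [folklore] -/
theorem exists_frame [Finite K] [FiniteDimensional K V] (hB : B.Nondegenerate) (hBs : B.IsSymm)
    (h2 : (2 : K) ≠ 0) (h4 : finrank K V = 4) :
    ∃ e f g : V, B e e = 0 ∧ B f f = 0 ∧ B e f = 1 ∧ B e g = 0 ∧ B f g = 0 ∧ B g g = 1 := by
  have : Finite V := Module.finite_of_finite K
  obtain ⟨e, he0, he⟩ := exists_null_ne_zero hB hBs h2 h4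
  obtain ⟨f, hf, hef⟩ := exists_hyperbolic_partner hB hBs h2 he0 he
  obtain ⟨hHp2, hB', hmemHp⟩ := orthogonal_hyperbolic_pair hB hBs h4 he hf hef
  set Hp := B.orthogonal (Submodule.span K ({e, f} : Set V)) with hHp
  have hBs' := isSymm_restrict hBs Hp
  have hpos : 0 < Nat.card {v : Hp // (B.restrict Hp) v v = 1} := by
    have h := card_le_natCard_level_two hB' hBs' h2 hHp2 (one_ne_zero (α := K))
    have hq := two_lt_card (K := K) h2
    omega
  obtain ⟨⟨g, hg⟩⟩ := (Nat.card_pos_iff.1 hpos).1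
  refine ⟨e, f, (g : V), he, hf, hef, ((hmemHp g).1 g.2).1, ((hmemHp g).1 g.2).2, ?_⟩
  simpa only [LinearMap.BilinForm.restrict_apply, LinearMap.domRestrict_apply] using hg

/-- **Both sharp bounds are attained, for every nondegenerate form:** some affine `3`-space
contains exactly `2 (q + 1)` lines of `L` and exactly `q² + q` points of `P` (`B` nondegenerate
symmetric on a `4`-space over `𝔽_q`, `q` odd; the `3`-space of a hyperbolic frame).  So the
constants of `ncard_lineSetIn_le_sharp` and `ncard_translate_inter_sphere_le_sharp` cannot be
improved, for either isometry class of `B`. [folklore] -/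
theorem exists_translate_ncard_eq [Finite K] [FiniteDimensional K V] (hB : B.Nondegenerate)
    (hBs : B.IsSymm) (h2 : (2 : K) ≠ 0) (h4 : finrank K V = 4) :
    ∃ (U : Submodule K V) (x₀ : V), finrank K U = 3 ∧
      (lineSetIn B (translate x₀ U)).ncard = 2 * (Nat.card K + 1) ∧
      (translate x₀ U ∩ sphere B).ncard = Nat.card K ^ 2 + Nat.card K := by
  obtain ⟨e, f, g, he, hf, hef, heg, hfg, hg⟩ := exists_frame hB hBs h2 h4
  exact ⟨_, 0, finrank_frame he hef heg hfg hg,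
    ncard_lineSetIn_frame hB hBs h2 h4 he hf hef heg hfg hg,
    ncard_translate_inter_sphere_frame hBs h2 he hf hef heg hfg hg⟩

end Attained



end Tao2005UnitSphere

end Literature.Combinatorics.Kakeya
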